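/-
Copyright (c) 2026 the pub-hodgecm-mathlib formalisation cell (harness21).  Prover seat hodgecm-mathlib-K2E3-p20 (g5), Track B «K2-LIT» ∕ h413
(`stmt-HodgeConjecture-24833`), line `K2_E3_EllipticInputs`, unit U12 §L, kernel road «RICHARDSON» for (L-B_GL) at `N = 3` (road owner K2E3-p11 (g4)),
brick (3-glue): (LBGL-ge3) AT `N = 3` FROM THE TWO SLICE DENSITIES `W_𝔟` (Borel) AND `W_𝔭` ((2,1)-parabolic) — the leaf currency of the dealer's re-tie (R15).  2026-09-04.
-/
import Summits.HodgeConjecture.HodgeConjecture.Theorems.K2E3GL3NilpotentFourierRegularOfOrbitFourier   -- ★ p857499 (this seat): (3-asm) over `hBE`, `hBJ`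
import Summits.HodgeConjecture.HodgeConjecture.Theorems.K2E3GL3RegularRichardsonFourier                 -- ★ p857495 (K2E3-p11 g4): (F-link-J) `Λ_J ∘ 𝓕 = C·(K-average of the Borel slice)`
import Summits.HodgeConjecture.HodgeConjecture.Theorems.K2E3GL3MinimalRichardsonFourier                 -- ★ p857532-class (K2E3-p11 g4): (F-link-E) `Λ_E ∘ 𝓕 = C·(K-average of the (2,1)-parabolic slice)`   [ED. 2]
import HarnessLib

/-!
# K2_E3 road (h413), §L — (LBGL-ge3) at `N = 3` from the Borel slice density `W_𝔟` (leaf (LBGL-3J)) and the regularity of `Λ̂_E`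

Cell `pub/hodgecm-mathlib` (D-0151), Track B, seat K2E3-p20 (g5); road owner K2E3-p11 (g4), dealer K2E3-plan (g3) (RULING R15: (LBGL-ge3) re-tied relatively by
`N`; `N = 3` over hosted leaves (LBGL-3J) `sig_K2E3GL3BorelSliceDensity`, (LBGL-3E) `sig_K2E3GL3ParabolicSliceDensity`).  `--supports stmt-HodgeConjecture-24833 --as helper`;
THEOREMS ONLY (no definition ∕ instance ∕ notation ∕ named fact ∕ `sorry`); never imports `Cruxes/…/Lines`.  COUNT-NEUTRAL ((L-B_GL) ∕ (LBGL-ge3) stay OPEN).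

★ p857499 `gl3_nilpotentFourierRegular_of_orbitFourier` reduces (LBGL-ge3)|_{N=3} to the regularity of the two orbit Fourier transforms `Λ̂_E`, `Λ̂_J` (shape `hB` of the
`N = 2` assembly).  ★ p857495 `exists_integral_prod_matrixFourier_borelRichardson_eq` (K2E3-p11 (g4)) is the Fourier bridge for the regular orbit:
`∫_{K×N₃} 𝓕f(Ad(k)(u − 1)) = C·∫_K ∫_{F⁶} f(Ad(k) b(r))`, `b(r) = [[r₀,r₁,r₂],[0,r₃,r₄],[0,0,r₅]]`.  Hence:
* §1 **`orbitFourierRegular_of_borelSliceDensity`** — the leaf (LBGL-3J) «BOREL SLICE DENSITY OF 𝔤𝔩₃» (`∃ W_𝔟` loc. int. with `∫_K∫_{F⁶} f(Ad(k) b(r)) = ∫ f·W_𝔟`, loc. const.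
  on `{disc χ ≠ 0}`, `|disc χ|^{1∕2}·|W_𝔟|` loc. bdd; road owner's 04:57:42Z bytes, K2E3-p17 (g6)'s (F-J) head) IMPLIES the `hBJ` hypothesis of ★ p857499 with `F_J = C·W_𝔟`;
* §2 **`gl3_nilpotentFourierRegular_of_borelSliceDensity`** — (LBGL-ge3)|_{N=3} for every `T ∈ J(𝒩)(𝔤𝔩₃(F))` from (LBGL-3J) in its `W_𝔟` currency and `hBE` (regularity of
  `Λ̂_E`, orbit-Fourier currency; its own bridge to the (2,1)-parabolic slice density `W_𝔭` is K2E3-p11 (g4)'s (F-link-E), docking in a later edition).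
[HarishChandra1999AdmissibleDistributions, Thm. 4.4 p. 11, §7; Thm. 3.9, Cor. 3.10]; [Howe1974, Prop. 3].

ED. 3 (docstring-only): one `[cite: …]` tag re-joined onto a single line (lit1 (g47) (5230)).
ED. 2 (same seat, 2026-09-04, append-only): §3 docks the (2,1)-parabolic half through ★ `exists_integral_prod_matrixFourier_minimalRichardson_eq` (K2E3-p11 (g4),
(F-link-E)): **`orbitFourierRegular_of_parabolicSliceDensity`** ((LBGL-3E) `W_𝔭` text ⟹ `hBE`, `F_E = C·W_𝔭`) and the fully leaf-currency assembly
**`gl3_nilpotentFourierRegular_of_sliceDensities`**: (LBGL-ge3)|_{N=3} ⟸ {(LBGL-3E) `W_𝔭`, (LBGL-3J) `W_𝔟`} — the two slice densities are the ONLY open inputs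
(Haar measures on `U₍₂,₁₎`, `N₃` are built inside).

HONEST LABEL: HC_CM is proved only modulo the 7 printed citations (2 remaining named inputs: hLiu418 = stmt-HodgeConjecture-24832, h413 = stmt-HodgeConjecture-24833)
until rung 0 closes; count-neutral helper.
-/

set_option autoImplicit false
set_option linter.dupNamespace false   -- `Summit.HodgeConjecture.HodgeConjecture.…` (D-0017 nested layout; lakefile exemption for Summits)

noncomputable section

open MeasureTheory Measure Filter Topology
open scoped MatrixGroups NNReal ENNReal
open Literature.NumberTheory.Rogawski1990 Literature.NumberTheory.Automorphic Literature.NumberTheory.Automorphic.LocalFieldHaar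
open Literature.NumberTheory.GaloisRepresentations Literature.NumberTheory.GaloisRepresentations.IsNonarchimedeanLocalField
open Summit.HodgeConjecture.HodgeConjecture.Cruxes.H413.K2E3GL3NilpotentFourierRegularOfOrbitFourier
open Summit.HodgeConjecture.HodgeConjecture.Cruxes.H413.K2E3GL3RegularRichardsonFourier
open Summit.HodgeConjecture.HodgeConjecture.Cruxes.H413.K2E3GL3MinimalRichardsonFourier   -- [ED. 2]

namespace Summit.HodgeConjecture.HodgeConjecture.Cruxes.H413.K2E3GL3NilpotentFourierRegularOfSliceDensities

variable {F : Type*} [Field F] [ValuativeRel F] [TopologicalSpace F] [IsNonarchimedeanLocalField F]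
  (ψ : AddChar F Circle) [MeasurableSpace (Matrix (Fin 3) (Fin 3) F)] [BorelSpace (Matrix (Fin 3) (Fin 3) F)]
  (μ𝔤 : Measure (Matrix (Fin 3) (Fin 3) F)) [μ𝔤.IsAddHaarMeasure]
  [MeasurableSpace F] [BorelSpace F] [MeasurableSpace (GL (Fin 3) F)] [BorelSpace (GL (Fin 3) F)]
  (κ : Measure ↥(glInt 3 F)) [IsHaarMeasure κ] (μU : Measure ↥(unipotentRadicalGL F ![false, false, true])) [IsHaarMeasure μU]
  (μN : Measure ↥(unipotentRadicalGL F (id : Fin 3 → Fin 3))) [IsHaarMeasure μN] (dx : Measure F) [dx.IsAddHaarMeasure]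

/-! ## §1  The Borel slice density `W_𝔟` gives the regularity of `Λ̂_J` (`F_J = C·W_𝔟`) -/

/-- **(LBGL-3J) ⟹ `hBJ`**: if `W_𝔟` is a locally integrable density for the `K`-average of the Borel slice — `∫_K∫_{F⁶} f(Ad(k) b(r)) d(dx^{⊗6}) dκ = ∫ f·W_𝔟 dμ𝔤` for
`f ∈ C_c^∞` — locally constant on `{disc χ ≠ 0}` with `|disc χ|^{1∕2}·|W_𝔟|` locally bounded, then `F_J := C·W_𝔟` (`C` the constant of ★ p857495) represents
`Λ_J ∘ 𝓕_ψ` with the same two regularity clauses. [cite: HarishChandra1999AdmissibleDistributions, Thm. 4.4 p. 11, §7] -/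
theorem orbitFourierRegular_of_borelSliceDensity (hψ : ψ.IsContinuousNontrivial)
    (hWJ : ∃ W : Matrix (Fin 3) (Fin 3) F → ℂ, LocallyIntegrable W μ𝔤 ∧
      (∀ f : Matrix (Fin 3) (Fin 3) F → ℂ, IsLocSmooth f →
        ∫ k : ↥(glInt 3 F), ∫ r : Fin 6 → F,
            f (((k : GL (Fin 3) F) : Matrix (Fin 3) (Fin 3) F) * !![r 0, r 1, r 2; 0, r 3, r 4; 0, 0, r 5] *
              ((((k : GL (Fin 3) F))⁻¹ : GL (Fin 3) F) : Matrix (Fin 3) (Fin 3) F)) ∂(Measure.pi fun _ : Fin 6 => dx) ∂κ = ∫ X, f X * W X ∂μ𝔤) ∧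
      (∀ X : Matrix (Fin 3) (Fin 3) F, IsUnit X.charpoly.discr → ∀ᶠ Y in 𝓝 X, W Y = W X) ∧
      (∀ C : Set (Matrix (Fin 3) (Fin 3) F), IsCompact C → ∃ B : ℝ, ∀ X ∈ C, ((NNReal.sqrt (normAbs F X.charpoly.discr) : ℝ≥0) : ℝ) * ‖W X‖ ≤ B)) :
    ∃ Fr : Matrix (Fin 3) (Fin 3) F → ℂ, LocallyIntegrable Fr μ𝔤 ∧
      (∀ f : Matrix (Fin 3) (Fin 3) F → ℂ, IsLocSmooth f →
        ∫ q : ↥(glInt 3 F) × ↥(unipotentRadicalGL F (id : Fin 3 → Fin 3)),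
            (fun Y : Matrix (Fin 3) (Fin 3) F => ∫ X, ((ψ (Matrix.trace (Y * X)) : Circle) : ℂ) * f X ∂μ𝔤)
              (((q.1 : GL (Fin 3) F) : Matrix (Fin 3) (Fin 3) F) * (((q.2 : GL (Fin 3) F) : Matrix (Fin 3) (Fin 3) F) - 1) *
                (((q.1 : GL (Fin 3) F)⁻¹ : GL (Fin 3) F) : Matrix (Fin 3) (Fin 3) F)) ∂(κ.prod μN) = ∫ X, f X * Fr X ∂μ𝔤) ∧
      (∀ X : Matrix (Fin 3) (Fin 3) F, IsUnit X.charpoly.discr → ∀ᶠ Y in 𝓝 X, Fr Y = Fr X) ∧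
      (∀ C : Set (Matrix (Fin 3) (Fin 3) F), IsCompact C → ∃ B : ℝ, ∀ X ∈ C, ((NNReal.sqrt (normAbs F X.charpoly.discr) : ℝ≥0) : ℝ) * ‖Fr X‖ ≤ B) := by
  obtain ⟨C, hC0, hC⟩ := exists_integral_prod_matrixFourier_borelRichardson_eq ψ hψ μ𝔤 κ μN dx
  obtain ⟨W, hW_int, hW_rep, hW_lc, hW_bd⟩ := hWJ
  refine ⟨fun X => (C : ℂ) * W X, ?_, fun f hf => ?_, fun X hX => ?_, fun K hK => ?_⟩
  · simpa only [Pi.smul_def, smul_eq_mul] using hW_int.smul (C : ℂ)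
  · rw [hC f hf, hW_rep f hf, ← integral_const_mul]
    refine integral_congr_ae (Eventually.of_forall fun X => ?_)
    simp only
    ring
  · exact (hW_lc X hX).mono fun Y hY => by simp only [hY]
  · obtain ⟨B, hB⟩ := hW_bd K hK
    refine ⟨‖(C : ℂ)‖ * B, fun X hX => ?_⟩
    rw [norm_mul, mul_left_comm]
    exact mul_le_mul_of_nonneg_left (hB X hX) (norm_nonneg _)

/-! ## §2  (LBGL-ge3) at `N = 3` from (LBGL-3J) and the regularity of `Λ̂_E` -/

/-- **(LBGL-ge3) AT `N = 3` FROM THE BOREL SLICE DENSITY AND THE REGULARITY OF `Λ̂_E`.**  `hWJ` = the leaf (LBGL-3J) «Borel slice density of 𝔤𝔩₃» in its own currency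
(`∫_K∫_{F⁶} f(Ad(k) b(r)) = ∫ f·W_𝔟`, local constancy, `|disc|^{1∕2}`-bound); `hBE` = regularity of the minimal orbit's Fourier transform `f ↦ ∫_{K×U₍₂,₁₎} 𝓕f(Ad(k)(u−1))`
(the `N = 2` `hB` shape).  THEN for every `T` with the four `J(𝒩)` clauses the conclusion of `sig_K2E3GLnNilpotentFourierRegularGeThree` holds at `N = 3`
(★ p857499 ∘ §1; `F_T = a + b·F_E + c·C·W_𝔟`). [cite: HarishChandra1999AdmissibleDistributions, Thm. 4.4 p. 11, Thm. 3.9, Cor. 3.10 p. 10] [cite: Howe1974, Prop. 3] -/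
theorem gl3_nilpotentFourierRegular_of_borelSliceDensity (hψ : ψ.IsContinuousNontrivial)
    (hBE : ∃ Fr : Matrix (Fin 3) (Fin 3) F → ℂ, LocallyIntegrable Fr μ𝔤 ∧
      (∀ f : Matrix (Fin 3) (Fin 3) F → ℂ, IsLocSmooth f →
        ∫ q : ↥(glInt 3 F) × ↥(unipotentRadicalGL F ![false, false, true]),
            (fun Y : Matrix (Fin 3) (Fin 3) F => ∫ X, ((ψ (Matrix.trace (Y * X)) : Circle) : ℂ) * f X ∂μ𝔤)
              ((((q.1 : GL (Fin 3) F)) : Matrix (Fin 3) (Fin 3) F) * ((((q.2 : GL (Fin 3) F)) : Matrix (Fin 3) (Fin 3) F) - 1) *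
                ((((q.1 : GL (Fin 3) F))⁻¹ : GL (Fin 3) F) : Matrix (Fin 3) (Fin 3) F)) ∂(κ.prod μU) = ∫ X, f X * Fr X ∂μ𝔤) ∧
      (∀ X : Matrix (Fin 3) (Fin 3) F, IsUnit X.charpoly.discr → ∀ᶠ Y in 𝓝 X, Fr Y = Fr X) ∧
      (∀ C : Set (Matrix (Fin 3) (Fin 3) F), IsCompact C → ∃ B : ℝ, ∀ X ∈ C, ((NNReal.sqrt (normAbs F X.charpoly.discr) : ℝ≥0) : ℝ) * ‖Fr X‖ ≤ B))
    (hWJ : ∃ W : Matrix (Fin 3) (Fin 3) F → ℂ, LocallyIntegrable W μ𝔤 ∧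
      (∀ f : Matrix (Fin 3) (Fin 3) F → ℂ, IsLocSmooth f →
        ∫ k : ↥(glInt 3 F), ∫ r : Fin 6 → F,
            f (((k : GL (Fin 3) F) : Matrix (Fin 3) (Fin 3) F) * !![r 0, r 1, r 2; 0, r 3, r 4; 0, 0, r 5] *
              ((((k : GL (Fin 3) F))⁻¹ : GL (Fin 3) F) : Matrix (Fin 3) (Fin 3) F)) ∂(Measure.pi fun _ : Fin 6 => dx) ∂κ = ∫ X, f X * W X ∂μ𝔤) ∧
      (∀ X : Matrix (Fin 3) (Fin 3) F, IsUnit X.charpoly.discr → ∀ᶠ Y in 𝓝 X, W Y = W X) ∧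
      (∀ C : Set (Matrix (Fin 3) (Fin 3) F), IsCompact C → ∃ B : ℝ, ∀ X ∈ C, ((NNReal.sqrt (normAbs F X.charpoly.discr) : ℝ≥0) : ℝ) * ‖W X‖ ≤ B))
    (T : (Matrix (Fin 3) (Fin 3) F → ℂ) → ℂ)
    (hT : (∀ f₁ f₂ : Matrix (Fin 3) (Fin 3) F → ℂ, IsLocSmooth f₁ → IsLocSmooth f₂ → T (f₁ + f₂) = T f₁ + T f₂) ∧
       (∀ (a : ℂ) (f : Matrix (Fin 3) (Fin 3) F → ℂ), IsLocSmooth f → T (a • f) = a * T f) ∧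
       (∀ (x : GL (Fin 3) F) (f : Matrix (Fin 3) (Fin 3) F → ℂ), IsLocSmooth f →
          T (fun X => f ((x : Matrix (Fin 3) (Fin 3) F) * X * ((x⁻¹ : GL (Fin 3) F) : Matrix (Fin 3) (Fin 3) F))) = T f) ∧
       (∀ f : Matrix (Fin 3) (Fin 3) F → ℂ, IsLocSmooth f → (∀ X ∈ tsupport f, ¬ IsNilpotent X) → T f = 0)) :
    ∃ Fn : Matrix (Fin 3) (Fin 3) F → ℂ, LocallyIntegrable Fn μ𝔤 ∧
      (∀ f : Matrix (Fin 3) (Fin 3) F → ℂ, IsLocSmooth f →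
          T (fun Y => ∫ X, ((ψ (Matrix.trace (Y * X)) : Circle) : ℂ) * f X ∂μ𝔤) = ∫ X, f X * Fn X ∂μ𝔤) ∧
      (∀ X : Matrix (Fin 3) (Fin 3) F, IsUnit X.charpoly.discr → ∀ᶠ Y in 𝓝 X, Fn Y = Fn X) ∧
      (∀ C : Set (Matrix (Fin 3) (Fin 3) F), IsCompact C → ∃ B : ℝ, ∀ X ∈ C,
          ((NNReal.sqrt (normAbs F X.charpoly.discr) : ℝ≥0) : ℝ) * ‖Fn X‖ ≤ B) :=
by
  -- a Haar measure on `N₃` to run ★ p857499 through (the conclusion does not depend on it)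
  haveI : T2Space F := (isLocalField F).toT2Space
  haveI : LocallyCompactSpace F := (isLocalField F).toLocallyCompactSpace
  haveI : T2Space (GL (Fin 3) F) := t2Space_generalLinearGroup F 3
  haveI : LocallyCompactSpace (GL (Fin 3) F) := locallyCompactSpace_generalLinearGroup F 3
  haveI : LocallyCompactSpace ↥(unipotentRadicalGL F (id : Fin 3 → Fin 3)) := (isClosed_unipotentRadicalGL (R := F) (id : Fin 3 → Fin 3)).locallyCompactSpace
  haveI : BorelSpace ↥(unipotentRadicalGL F (id : Fin 3 → Fin 3)) := Subtype.borelSpace _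
  exact gl3_nilpotentFourierRegular_of_orbitFourier ψ μ𝔤 κ μU (haar : Measure ↥(unipotentRadicalGL F (id : Fin 3 → Fin 3))) hψ hBE
    (orbitFourierRegular_of_borelSliceDensity ψ μ𝔤 κ haar dx hψ hWJ) T hT

/-! ## §3 (ED. 2)  The (2,1)-parabolic slice density `W_𝔭` gives the regularity of `Λ̂_E`; (LBGL-ge3) at `N = 3` from the two slice densities -/

/-- **(LBGL-3E) ⟹ `hBE`** (ED. 2): if `W_𝔭` is a locally integrable density for the `K`-average of the `(2,1)`-parabolic slice —
`∫_K∫_{F⁷} f(Ad(k) p(r)) d(dx^{⊗7}) dκ = ∫ f·W_𝔭 dμ𝔤`, `p(r) = [[r₀,r₁,r₂],[r₃,r₄,r₅],[0,0,r₆]]` — locally constant on `{disc χ ≠ 0}` with `|disc χ|^{1∕2}·|W_𝔭|`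
locally bounded, then `F_E := C·W_𝔭` (`C` the constant of ★ `exists_integral_prod_matrixFourier_minimalRichardson_eq`) represents `Λ_E ∘ 𝓕_ψ` with the same two
regularity clauses. [cite: HarishChandra1999AdmissibleDistributions, Thm. 4.4 p. 11, §7] -/
theorem orbitFourierRegular_of_parabolicSliceDensity (hψ : ψ.IsContinuousNontrivial)
    (hWE : ∃ W : Matrix (Fin 3) (Fin 3) F → ℂ, LocallyIntegrable W μ𝔤 ∧
      (∀ f : Matrix (Fin 3) (Fin 3) F → ℂ, IsLocSmooth f →
        ∫ k : ↥(glInt 3 F), ∫ r : Fin 7 → F,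
            f (((k : GL (Fin 3) F) : Matrix (Fin 3) (Fin 3) F) * !![r 0, r 1, r 2; r 3, r 4, r 5; 0, 0, r 6] *
              ((((k : GL (Fin 3) F))⁻¹ : GL (Fin 3) F) : Matrix (Fin 3) (Fin 3) F)) ∂(Measure.pi fun _ : Fin 7 => dx) ∂κ = ∫ X, f X * W X ∂μ𝔤) ∧
      (∀ X : Matrix (Fin 3) (Fin 3) F, IsUnit X.charpoly.discr → ∀ᶠ Y in 𝓝 X, W Y = W X) ∧
      (∀ C : Set (Matrix (Fin 3) (Fin 3) F), IsCompact C → ∃ B : ℝ, ∀ X ∈ C, ((NNReal.sqrt (normAbs F X.charpoly.discr) : ℝ≥0) : ℝ) * ‖W X‖ ≤ B)) :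
    ∃ Fr : Matrix (Fin 3) (Fin 3) F → ℂ, LocallyIntegrable Fr μ𝔤 ∧
      (∀ f : Matrix (Fin 3) (Fin 3) F → ℂ, IsLocSmooth f →
        ∫ q : ↥(glInt 3 F) × ↥(unipotentRadicalGL F ![false, false, true]),
            (fun Y : Matrix (Fin 3) (Fin 3) F => ∫ X, ((ψ (Matrix.trace (Y * X)) : Circle) : ℂ) * f X ∂μ𝔤)
              ((((q.1 : GL (Fin 3) F)) : Matrix (Fin 3) (Fin 3) F) * ((((q.2 : GL (Fin 3) F)) : Matrix (Fin 3) (Fin 3) F) - 1) *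
                ((((q.1 : GL (Fin 3) F))⁻¹ : GL (Fin 3) F) : Matrix (Fin 3) (Fin 3) F)) ∂(κ.prod μU) = ∫ X, f X * Fr X ∂μ𝔤) ∧
      (∀ X : Matrix (Fin 3) (Fin 3) F, IsUnit X.charpoly.discr → ∀ᶠ Y in 𝓝 X, Fr Y = Fr X) ∧
      (∀ C : Set (Matrix (Fin 3) (Fin 3) F), IsCompact C → ∃ B : ℝ, ∀ X ∈ C, ((NNReal.sqrt (normAbs F X.charpoly.discr) : ℝ≥0) : ℝ) * ‖Fr X‖ ≤ B) := by
  obtain ⟨C, hC0, hC⟩ := exists_integral_prod_matrixFourier_minimalRichardson_eq ψ hψ μ𝔤 κ μU dx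
  obtain ⟨W, hW_int, hW_rep, hW_lc, hW_bd⟩ := hWE
  refine ⟨fun X => (C : ℂ) * W X, ?_, fun f hf => ?_, fun X hX => ?_, fun K hK => ?_⟩
  · simpa only [Pi.smul_def, smul_eq_mul] using hW_int.smul (C : ℂ)
  · rw [hC f hf, hW_rep f hf, ← integral_const_mul]
    refine integral_congr_ae (Eventually.of_forall fun X => ?_)
    simp only
    ring
  · exact (hW_lc X hX).mono fun Y hY => by simp only [hY]
  · obtain ⟨B, hB⟩ := hW_bd K hK
    refine ⟨‖(C : ℂ)‖ * B, fun X hX => ?_⟩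
    rw [norm_mul, mul_left_comm]
    exact mul_le_mul_of_nonneg_left (hB X hX) (norm_nonneg _)

/-- **(LBGL-ge3) AT `N = 3` FROM THE TWO SLICE DENSITIES** (ED. 2).  `hWE` = the leaf (LBGL-3E) «(2,1)-parabolic slice density `W_𝔭` of 𝔤𝔩₃» and `hWJ` = the leaf
(LBGL-3J) «Borel slice density `W_𝔟` of 𝔤𝔩₃», each in its own four-clause currency (`K`-average of the slice in the chart `Fin 7 → F` ∕ `Fin 6 → F` against
`κ ⊗ dx^{⊗7}` ∕ `κ ⊗ dx^{⊗6}`; `κ` Haar on `GL₃(𝒪)`, `dx` additive Haar on `F`).  THEN for every `T` with the four `J(𝒩)` clauses the conclusion of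
`sig_K2E3GLnNilpotentFourierRegularGeThree` holds at `N = 3`: `F_T = a + b·C_E·W_𝔭 + c·C_J·W_𝔟` (★ p857499 over ★ p857476 structure, the links ★ p857495 ∕ ★
`exists_integral_prod_matrixFourier_minimalRichardson_eq`, and Haar measures on `U₍₂,₁₎`, `N₃` built here).
[cite: HarishChandra1999AdmissibleDistributions, Thm. 4.4 p. 11, Thm. 3.9, Cor. 3.10 p. 10] [cite: Howe1974, Prop. 3] -/
theorem gl3_nilpotentFourierRegular_of_sliceDensities (hψ : ψ.IsContinuousNontrivial)
    (hWE : ∃ W : Matrix (Fin 3) (Fin 3) F → ℂ, LocallyIntegrable W μ𝔤 ∧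
      (∀ f : Matrix (Fin 3) (Fin 3) F → ℂ, IsLocSmooth f →
        ∫ k : ↥(glInt 3 F), ∫ r : Fin 7 → F,
            f (((k : GL (Fin 3) F) : Matrix (Fin 3) (Fin 3) F) * !![r 0, r 1, r 2; r 3, r 4, r 5; 0, 0, r 6] *
              ((((k : GL (Fin 3) F))⁻¹ : GL (Fin 3) F) : Matrix (Fin 3) (Fin 3) F)) ∂(Measure.pi fun _ : Fin 7 => dx) ∂κ = ∫ X, f X * W X ∂μ𝔤) ∧
      (∀ X : Matrix (Fin 3) (Fin 3) F, IsUnit X.charpoly.discr → ∀ᶠ Y in 𝓝 X, W Y = W X) ∧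
      (∀ C : Set (Matrix (Fin 3) (Fin 3) F), IsCompact C → ∃ B : ℝ, ∀ X ∈ C, ((NNReal.sqrt (normAbs F X.charpoly.discr) : ℝ≥0) : ℝ) * ‖W X‖ ≤ B))
    (hWJ : ∃ W : Matrix (Fin 3) (Fin 3) F → ℂ, LocallyIntegrable W μ𝔤 ∧
      (∀ f : Matrix (Fin 3) (Fin 3) F → ℂ, IsLocSmooth f →
        ∫ k : ↥(glInt 3 F), ∫ r : Fin 6 → F,
            f (((k : GL (Fin 3) F) : Matrix (Fin 3) (Fin 3) F) * !![r 0, r 1, r 2; 0, r 3, r 4; 0, 0, r 5] *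
              ((((k : GL (Fin 3) F))⁻¹ : GL (Fin 3) F) : Matrix (Fin 3) (Fin 3) F)) ∂(Measure.pi fun _ : Fin 6 => dx) ∂κ = ∫ X, f X * W X ∂μ𝔤) ∧
      (∀ X : Matrix (Fin 3) (Fin 3) F, IsUnit X.charpoly.discr → ∀ᶠ Y in 𝓝 X, W Y = W X) ∧
      (∀ C : Set (Matrix (Fin 3) (Fin 3) F), IsCompact C → ∃ B : ℝ, ∀ X ∈ C, ((NNReal.sqrt (normAbs F X.charpoly.discr) : ℝ≥0) : ℝ) * ‖W X‖ ≤ B))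
    (T : (Matrix (Fin 3) (Fin 3) F → ℂ) → ℂ)
    (hT : (∀ f₁ f₂ : Matrix (Fin 3) (Fin 3) F → ℂ, IsLocSmooth f₁ → IsLocSmooth f₂ → T (f₁ + f₂) = T f₁ + T f₂) ∧
       (∀ (a : ℂ) (f : Matrix (Fin 3) (Fin 3) F → ℂ), IsLocSmooth f → T (a • f) = a * T f) ∧
       (∀ (x : GL (Fin 3) F) (f : Matrix (Fin 3) (Fin 3) F → ℂ), IsLocSmooth f →
          T (fun X => f ((x : Matrix (Fin 3) (Fin 3) F) * X * ((x⁻¹ : GL (Fin 3) F) : Matrix (Fin 3) (Fin 3) F))) = T f) ∧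
       (∀ f : Matrix (Fin 3) (Fin 3) F → ℂ, IsLocSmooth f → (∀ X ∈ tsupport f, ¬ IsNilpotent X) → T f = 0)) :
    ∃ Fn : Matrix (Fin 3) (Fin 3) F → ℂ, LocallyIntegrable Fn μ𝔤 ∧
      (∀ f : Matrix (Fin 3) (Fin 3) F → ℂ, IsLocSmooth f →
          T (fun Y => ∫ X, ((ψ (Matrix.trace (Y * X)) : Circle) : ℂ) * f X ∂μ𝔤) = ∫ X, f X * Fn X ∂μ𝔤) ∧
      (∀ X : Matrix (Fin 3) (Fin 3) F, IsUnit X.charpoly.discr → ∀ᶠ Y in 𝓝 X, Fn Y = Fn X) ∧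
      (∀ C : Set (Matrix (Fin 3) (Fin 3) F), IsCompact C → ∃ B : ℝ, ∀ X ∈ C,
          ((NNReal.sqrt (normAbs F X.charpoly.discr) : ℝ≥0) : ℝ) * ‖Fn X‖ ≤ B) := by
  -- Haar measures on `U₍₂,₁₎` and `N₃` to run ★ p857499 through (the conclusion does not depend on them)
  haveI : T2Space F := (isLocalField F).toT2Space
  haveI : LocallyCompactSpace F := (isLocalField F).toLocallyCompactSpace
  haveI : T2Space (GL (Fin 3) F) := t2Space_generalLinearGroup F 3
  haveI : LocallyCompactSpace (GL (Fin 3) F) := locallyCompactSpace_generalLinearGroup F 3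
  haveI : LocallyCompactSpace ↥(unipotentRadicalGL F (id : Fin 3 → Fin 3)) := (isClosed_unipotentRadicalGL (R := F) (id : Fin 3 → Fin 3)).locallyCompactSpace
  haveI : BorelSpace ↥(unipotentRadicalGL F (id : Fin 3 → Fin 3)) := Subtype.borelSpace _
  haveI : LocallyCompactSpace ↥(unipotentRadicalGL F ![false, false, true]) := (isClosed_unipotentRadicalGL (R := F) ![false, false, true]).locallyCompactSpace
  haveI : BorelSpace ↥(unipotentRadicalGL F ![false, false, true]) := Subtype.borelSpace _
  exact gl3_nilpotentFourierRegular_of_orbitFourier ψ μ𝔤 κ (haar : Measure ↥(unipotentRadicalGL F ![false, false, true]))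
    (haar : Measure ↥(unipotentRadicalGL F (id : Fin 3 → Fin 3))) hψ (orbitFourierRegular_of_parabolicSliceDensity ψ μ𝔤 κ haar dx hψ hWE)
    (orbitFourierRegular_of_borelSliceDensity ψ μ𝔤 κ haar dx hψ hWJ) T hT

end Summit.HodgeConjecture.HodgeConjecture.Cruxes.H413.K2E3GL3NilpotentFourierRegularOfSliceDensities

end
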